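import Mathlib.Topology.Instances.ZMod
import Mathlib.Topology.Algebra.Constructions
import Literature.IUT.HodgeTheaters.TemperedCoverings
import HarnessLib

/-!
# [IUTchI] Cor. 2.3 (ii), (iii), (v), Cor. 2.5 (inertia part): the predicates `Cor23ii`, `Cor23iii`, `Cor23v`,
# `Cor25Inertia` on `StableCurveTemperedData` are SCHEMAS — universal-closure certificates (proof-only)

S. Mochizuki, *Inter-universal Teichmüller theory I*, kurims manuscript (May 2020), §2, Corollary 2.3 (ii), (iii), (v)
pp. 47–48 and Corollary 2.5 p. 51 [claim: Mochizuki2012, status: disputed] (IUTchI §2 Cor 2.3 / Cor 2.5, kurims pp.47-51).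
abc-iut cell, K-L6 slice of «cone below S, unconditional» (D-0079 L-K; abc-iut-w4-d007 gen 10, row «KL6-CLOSURE-CERTS»).
PROOF-ONLY companion of abc-iut-L5-t1's `TemperedCoverings.lean` (no `def`, no `instance`, nothing re-typed).

The four frozen FACT-LIST rows **F-2593** `StableCurveTemperedData.Cor23ii`, **F-2595** `…Cor23iii`, **F-2597** `…Cor23v`,
**F-2603** `…Cor25Inertia` occur in HYPOTHESIS position inside the typed statements of the L6 cone rows IUTchII:Cor2.4(i),
IUTchII:Cor2.4(ii), IUTchII:Prop2.2(i) (abc-iut-w5-d012 `L6-SLICE-INPUT-CENSUS-v2`, ca24e4516e42b12c) and were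
«undecided» (labels `conditional` / `model-witness`): an instance-form theorem existed, a universal-closure decision did
not.  Each is a `Prop`-valued structure on an ARBITRARY `D : StableCurveTemperedData` — an interface record whose fields
(`Π^tp_X ↪ Π̂_X ↠ G_k`, the special-fibre data `Π^tp_ℍ ⊆ Π^tp_𝔾 ↪ Π̂_𝔾 ⊇ Π̂_ℍ`, cusps, inertia groups) are constrained
only by the structure's axioms (`tpH_le : Π^tp_ℍ ↪ Π̂_ℍ`, injectivity/continuity of `ι`, surjectivity of the projections).
The interface admits DEGENERATE inhabitants, and at one of them all four predicates fail; so their universal closures are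
false and the rows are consumable AT THE GENUINE DATUM ONLY (FACT-LIST class «universal-closure REFUTED / schema;
instance forms …»), where the tree already holds the instance-form theorems:

* F-2593 `Cor23ii`  — `StableCurveTemperedData.cor23ii_ofSpecialFibre` (abc-iut L5, `TemperedCoveringsCor23iiOfSpecialFibre`),
  `cor23ii_of_density`, and the free-group consistency model `FreeModel.cor23ii`;
* F-2595 `Cor23iii` — `cor23iii_ofSpecialFibre_of_slim`, `cor23iii_of_slim`, `cor23iii_of_slim_mlf`;
* F-2597 `Cor23v`   — `cor23v_of_graph`, `FreeModel.cor23v` (M. Hall's theorem in `F̂₂`);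
* F-2603 `Cor25Inertia` — `cor25Inertia_of_prop24i` (needs `[Nonempty D.Cusp]` — exactly the clause that fails below).

THE DEGENERATE DATUM (inline, no definition): `Π^tp_𝔾 = Π̂_𝔾 = Π^tp_X = Π̂_X = ℤ/2ℤ` (discrete, `ι = id`), `G_k = 1`,
`Σ = {3} ⊆ Σ̂ = {all primes}`, `p = 2`, `Π^tp_ℍ = 1` but `Π̂_ℍ = ℤ/2ℤ` (allowed: the interface only asks `Π^tp_ℍ ↪ Π̂_ℍ`),
NO cusps, one point.  Then `Δ^tp_{X,ℍ} = 1`, `Δ̂_{X,ℍ} = ℤ/2ℤ`, so (ii) «closure of `Δ^tp_{X,ℍ}` is `Δ̂_{X,ℍ}`» and (v)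
«`Δ̂_{X,ℍ} ∩ Δ^tp_X = Δ^tp_{X,ℍ}`» read `1 = ℤ/2ℤ`; (iii) asks the abelian `Δ̂_{X,ℍ} = ℤ/2ℤ` to be centre-free (its
hypothesis (b) `Σ̂ = Primes` holds); and Cor. 2.5's second clause at `γ = 1` reads «(∃ a cusp …) ↔ True» with no cusps.
General lemmas first (`not_cor23v_of_bot_top`, `not_cor23ii_of_bot_top`, `not_cor23iii_of_central`,
`not_cor25Inertia_of_isEmpty_cusp`: WHICH degeneration kills which clause), then ONE existential witness and the four
closed certificates `not_forall_cor23ii`, `not_forall_cor23iii`, `not_forall_cor23v`, `not_forall_cor25Inertia`.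

HONEST FRAMING: a refuted universal closure is a statement about OUR typing (the interface record admits degenerate
inhabitants), not about the printed corollaries, which concern the genuine tempered/profinite fundamental groups of a
pointed stable curve (there `Π^tp ↪ Π̂` is a dense embedding, `Π̂_ℍ` is the closure of `Π^tp_ℍ`, cusps exist); the
genuine instances are the theorems listed above.  Nothing here bears on [IUTchIII] Cor. 3.12 or takes a side; typed ≠
proved; nothing asserts abc proved or refuted.
-/

namespace Literature.IUT.HodgeTheaters

namespace StableCurveTemperedData

open Topology
open scoped Pointwise

universe u

variable (D : StableCurveTemperedData.{u})

/-! ## Which degeneration kills which clause -/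

/-- **IUTchI:Cor2.3(v)** (kurims p.48) fails whenever `Π^tp_ℍ = 1`, `Π̂_ℍ = Π̂_𝔾`, `Δ^tp_X ↠ Π^tp_𝔾` is injective,
`Δ^tp_X → Δ̂_X` is onto and `Δ̂_X ≠ 1`: then `Δ̂_{X,ℍ} ∩ Δ^tp_X = Δ̂_X` but `Δ^tp_{X,ℍ} = 1`.
[claim: Mochizuki2012, status: disputed] (IUTchI §2 Cor 2.3 (v), kurims p.48) -/
theorem not_cor23v_of_bot_top (hT : D.graph.TpH = ⊥) (hH : D.graph.HatH = ⊤) (hρ : Function.Injective D.ρTp)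
    (hι : Function.Surjective D.ιΔ) [Nontrivial D.DeltaHat] : ¬ D.Cor23v := by
  intro h
  have h1 : D.deltaTpH = ⊥ := by
    rw [deltaTpH, hT, MonoidHom.comap_bot, MonoidHom.ker_eq_bot_iff]
    exact hρ
  have h2 : D.deltaHatH = ⊤ := by
    rw [deltaHatH, hH, Subgroup.comap_top]
  have h3 : D.ιΔ.range = ⊤ := MonoidHom.range_eq_top.mpr hι
  have key := h.inf_eq
  rw [h1, h2, h3, Subgroup.map_bot, top_inf_eq] at key
  exact top_ne_bot key

/-- **IUTchI:Cor2.3(ii)** (kurims p.47) fails under the same degeneration when moreover points of `Δ̂_X` are closed: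
the closure of `Δ^tp_{X,ℍ} = 1` is `1 ≠ Δ̂_X = Δ̂_{X,ℍ}`. [claim: Mochizuki2012, status: disputed] (IUTchI §2 Cor 2.3 (ii), kurims p.47) -/
theorem not_cor23ii_of_bot_top (hT : D.graph.TpH = ⊥) (hH : D.graph.HatH = ⊤) (hρ : Function.Injective D.ρTp)
    [T1Space D.DeltaHat] [Nontrivial D.DeltaHat] : ¬ D.Cor23ii := by
  intro h
  have h1 : D.deltaTpH = ⊥ := by
    rw [deltaTpH, hT, MonoidHom.comap_bot, MonoidHom.ker_eq_bot_iff]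
    exact hρ
  have h2 : D.deltaHatH = ⊤ := by
    rw [deltaHatH, hH, Subgroup.comap_top]
  have key := h.closure_eq
  rw [h1, h2, Subgroup.map_bot] at key
  have hbot : ((⊥ : Subgroup D.DeltaHat).topologicalClosure : Set D.DeltaHat) = {1} := by
    rw [Subgroup.topologicalClosure_coe, Subgroup.coe_bot, closure_singleton]
  have htop : ((⊥ : Subgroup D.DeltaHat).topologicalClosure : Set D.DeltaHat) = Set.univ := by
    rw [key, Subgroup.coe_top]
  rw [hbot] at htop
  obtain ⟨x, hx⟩ := exists_ne (1 : D.DeltaHat)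
  have hx' : x ∈ ({1} : Set D.DeltaHat) := by rw [htop]; exact Set.mem_univ x
  exact hx hx'

/-- **IUTchI:Cor2.3(iii)** (kurims p.47) fails whenever its hypothesis (a)/(b) holds, `Π̂_ℍ = Π̂_𝔾`, and `Δ̂_X` has a
non-trivial central element (then `Δ̂_{X,ℍ} = Δ̂_X` is not centre-free). [claim: Mochizuki2012, status: disputed] (IUTchI §2 Cor 2.3 (iii), kurims p.47) -/
theorem not_cor23iii_of_central (hhyp : D.Cor23Hyp) (hH : D.graph.HatH = ⊤) (z : D.DeltaHat) (hz1 : z ≠ 1)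
    (hz : ∀ g : D.DeltaHat, g * z = z * g) : ¬ D.Cor23iii := by
  intro h
  have h2 : D.deltaHatH = ⊤ := by
    rw [deltaHatH, hH, Subgroup.comap_top]
  have hcen := (h.center_eq_bot hhyp).2.2.1
  have hzmem : z ∈ D.deltaHatH := by rw [h2]; exact Subgroup.mem_top z
  have hzc : (⟨z, hzmem⟩ : D.deltaHatH) ∈ Subgroup.center D.deltaHatH := by
    rw [Subgroup.mem_center_iff]
    intro g
    exact Subtype.ext (hz g)
  rw [hcen, Subgroup.mem_bot] at hzc
  exact hz1 (congrArg Subtype.val hzc)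

/-- **IUTchI:Cor2.5** (kurims p.51), inertia part, fails whenever `Σ̂ = Primes` and there are NO cusps: its second clause
at `γ = 1` reads «(∃ cusp …) ↔ (Π^tp_X = Π^tp_X)». (The instance-form theorem `cor25Inertia_of_prop24i` accordingly carries
`[Nonempty D.Cusp]`.) [claim: Mochizuki2012, status: disputed] (IUTchI §2 Cor 2.5, kurims p.51) -/
theorem not_cor25Inertia_of_isEmpty_cusp (hS : D.graph.SigmaHat = {q | q.Prime}) [IsEmpty D.Cusp] :
    ¬ D.Cor25Inertia := by
  intro h
  have key := (h.conj_eq_iff hS 1).mpr (by rw [map_one, one_smul])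
  obtain ⟨x, -⟩ := key
  exact IsEmpty.false x

/-! ## The degenerate inhabitant and the four closed certificates -/

/-- **One degenerate inhabitant of the interface falsifies all four predicates**: `Π^tp = Π̂ = ℤ/2ℤ` at both graph and
curve level (`ι = id`, discrete), `G_k = 1`, `Σ = {3}`, `Σ̂ = Primes`, `p = 2`, `Π^tp_ℍ = 1`, `Π̂_ℍ = ℤ/2ℤ`, no cusps.
[claim: Mochizuki2012, status: disputed] (IUTchI §2 Cor 2.3 / Cor 2.5, kurims pp.47-51) -/
theorem exists_not_cor23ii_cor23iii_cor23v_cor25Inertia :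
    ∃ D : StableCurveTemperedData.{0}, ¬ D.Cor23ii ∧ ¬ D.Cor23iii ∧ ¬ D.Cor23v ∧ ¬ D.Cor25Inertia := by
  let G : TemperedGraphGroupData.{0} :=
    { Sigma := {3}
      SigmaHat := {q | q.Prime}
      sigma_subset := by
        intro q hq
        rw [Set.mem_singleton_iff] at hq
        subst hq
        exact Nat.prime_three
      sigma_nonempty := ⟨3, rfl⟩
      sigmaHat_prime := fun _ hq => hq
      Tp := Multiplicative (ZMod 2)
      Hat := Multiplicative (ZMod 2)
      ι := MonoidHom.id _
      ι_continuous := continuous_id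
      ι_injective := fun _ _ h => h
      TpH := ⊥
      HatH := ⊤
      tpH_le := le_top }
  let D : StableCurveTemperedData.{0} :=
    { graph := G
      p := 2
      p_notMem := by
        show (2 : ℕ) ∉ ({3} : Set ℕ)
        simp
      PiTp := Multiplicative (ZMod 2)
      PiHat := Multiplicative (ZMod 2)
      Gk := Multiplicative (ZMod 1)
      ιX := MonoidHom.id _
      ιX_continuous := continuous_id
      ιX_injective := fun _ _ h => h
      prTp := 1
      prHat := 1
      prTp_surjective := fun _ => ⟨1, Subsingleton.elim _ _⟩
      prHat_comp := by ext; exact Subsingleton.elim _ _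
      ρTp := (1 : Multiplicative (ZMod 2) →* Multiplicative (ZMod 1)).ker.subtype
      ρHat := (1 : Multiplicative (ZMod 2) →* Multiplicative (ZMod 1)).ker.subtype
      ρTp_surjective := fun x => ⟨⟨x, by simp⟩, rfl⟩
      ρHat_surjective := fun x => ⟨⟨x, by simp⟩, rfl⟩
      ρ_comp := fun _ => rfl
      Cusp := PEmpty
      inertiaTp := fun x => nomatch x
      cuspMeetsH := fun _ => True
      Pt := PUnit
      decompTp := fun _ => ⊤ }
  have hT : D.graph.TpH = ⊥ := rfl
  have hH : D.graph.HatH = ⊤ := rfl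
  have hS : D.graph.SigmaHat = {q | q.Prime} := rfl
  have hρ : Function.Injective D.ρTp := Subtype.val_injective
  have hι : Function.Surjective D.ιΔ := by
    rintro ⟨y, hy⟩
    exact ⟨⟨y, by simp [D]⟩, Subtype.ext rfl⟩
  -- the non-trivial element `-1 ∈ ℤ/2ℤ = Δ̂_X` (the kernel of `Π̂_X ↠ G_k = 1` is everything)
  have hmem : (Multiplicative.ofAdd (1 : ZMod 2)) ∈ D.DeltaHat := by simp [D]
  let z : D.DeltaHat := ⟨Multiplicative.ofAdd (1 : ZMod 2), hmem⟩
  have hz1 : z ≠ 1 := by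
    intro h
    have h' : Multiplicative.ofAdd (1 : ZMod 2) = (1 : Multiplicative (ZMod 2)) := congrArg Subtype.val h
    exact absurd h' (by decide)
  haveI : Nontrivial D.DeltaHat := ⟨⟨z, 1, hz1⟩⟩
  have hz : ∀ g : D.DeltaHat, g * z = z * g := fun g => Subtype.ext (mul_comm (g : Multiplicative (ZMod 2)) z)
  have hhyp : D.Cor23Hyp := ⟨Or.inr hS⟩
  haveI : IsEmpty D.Cusp := PEmpty.instIsEmpty
  exact ⟨D, D.not_cor23ii_of_bot_top hT hH hρ, D.not_cor23iii_of_central hhyp hH z hz1 hz,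
    D.not_cor23v_of_bot_top hT hH hρ hι, D.not_cor25Inertia_of_isEmpty_cusp hS⟩

/-- **F-2593 is a schema**: the universal closure of `StableCurveTemperedData.Cor23ii` is FALSE (instance form for the
cone: `cor23ii_ofSpecialFibre` / `cor23ii_of_density`). [claim: Mochizuki2012, status: disputed] (IUTchI §2 Cor 2.3 (ii), kurims p.47) -/
theorem not_forall_cor23ii : ¬ ∀ D : StableCurveTemperedData.{0}, D.Cor23ii := fun h => by
  obtain ⟨D, h1, -, -, -⟩ := exists_not_cor23ii_cor23iii_cor23v_cor25Inertia
  exact h1 (h D)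

/-- **F-2595 is a schema**: the universal closure of `StableCurveTemperedData.Cor23iii` is FALSE (instance form for the
cone: `cor23iii_ofSpecialFibre_of_slim` / `cor23iii_of_slim`). [claim: Mochizuki2012, status: disputed] (IUTchI §2 Cor 2.3 (iii), kurims p.47) -/
theorem not_forall_cor23iii : ¬ ∀ D : StableCurveTemperedData.{0}, D.Cor23iii := fun h => by
  obtain ⟨D, -, h2, -, -⟩ := exists_not_cor23ii_cor23iii_cor23v_cor25Inertia
  exact h2 (h D)

/-- **F-2597 is a schema**: the universal closure of `StableCurveTemperedData.Cor23v` is FALSE (instance form for the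
cone: `cor23v_of_graph`; consistency model `FreeModel.cor23v`). [claim: Mochizuki2012, status: disputed] (IUTchI §2 Cor 2.3 (v), kurims p.48) -/
theorem not_forall_cor23v : ¬ ∀ D : StableCurveTemperedData.{0}, D.Cor23v := fun h => by
  obtain ⟨D, -, -, h3, -⟩ := exists_not_cor23ii_cor23iii_cor23v_cor25Inertia
  exact h3 (h D)

/-- **F-2603 is a schema**: the universal closure of `StableCurveTemperedData.Cor25Inertia` is FALSE (instance form for
the cone: `cor25Inertia_of_prop24i`, at data WITH cusps). [claim: Mochizuki2012, status: disputed] (IUTchI §2 Cor 2.5, kurims p.51) -/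
theorem not_forall_cor25Inertia : ¬ ∀ D : StableCurveTemperedData.{0}, D.Cor25Inertia := fun h => by
  obtain ⟨D, -, -, -, h4⟩ := exists_not_cor23ii_cor23iii_cor23v_cor25Inertia
  exact h4 (h D)

end StableCurveTemperedData

end Literature.IUT.HodgeTheaters
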